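import Summits.HodgeConjecture.HodgeConjecture.Theorems.F0P6aRGDAssemblyDefs
import Summits.HodgeConjecture.HodgeConjecture.Theorems.F0P6aPELInputs
import Summits.HodgeConjecture.HodgeConjecture.Theorems.F0P6aPELSpreadDefs
import Summits.HodgeConjecture.HodgeConjecture.Theorems.F0P6aStubGSPREAD
import Summits.HodgeConjecture.HodgeConjecture.Theorems.F0P6aStubGEN
import Literature.AlgebraicGeometry.AbelianSchemes.DualPairOfAmpleRigidified
import Summits.HodgeConjecture.HodgeConjecture.Theorems.F0P6aDatumOfLine
import HarnessLib
import HarnessLib.Audit.LibrarySuggestionsDenyListCruxes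

/-!
## Import provenance (CANONICAL HEADER — LEAD F0P6-plan (g6) «M-142a» (A): bare `import` lines only; their provenance notes, verbatim)

- `import Summits.HodgeConjecture.HodgeConjecture.Theorems.F0P6aRGDAssemblyDefs` -- ★ K5-H1 home of THIS hub՚s definitions and sorry-free heads (tree bytes minus the three blocks below; namespace kept): `HeckeRoofsΩ` … `RGDInputsAt`, `RecordPELInputsCofinal`, `RecordDatumOfInputs`, `rgd_of_inputs`, §4 `DockPackage` … `blockDock_of_inputs`
- `import Summits.HodgeConjecture.HodgeConjecture.Theorems.F0P6aPELInputs` -- [ED. 7] ★ home of the P-LINE head `F0P6aPELInputs.pel_of_inputs` (payer of `stub_PEL`, outer)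
- `import Summits.HodgeConjecture.HodgeConjecture.Theorems.F0P6aPELSpreadDefs` -- [ED. 7] ★ K5-H3 home of `F0P6aPELSpread.spread_of_parts` ∕ the PAID `F0P6aPELSpread.stub_INJ0` (payer of `stub_PEL`, SPREAD slot)
- `import Summits.HodgeConjecture.HodgeConjecture.Theorems.F0P6aStubGSPREAD` -- [ED. 7] ★ p853238 (A2) GSPREAD closer leaf head `F0P6aStubGSPREAD.gspread_of_line` (payer of `stub_PEL`, GSPREAD slot)
- `import Summits.HodgeConjecture.HodgeConjecture.Theorems.F0P6aStubGEN` -- [ED. 7] ★ p853316 GEN closer leaf head `F0P6aStubGEN.elaws_of_line` (payer of `stub_PEL`, ELAWS slot)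
- `import Literature.AlgebraicGeometry.AbelianSchemes.DualPairOfAmpleRigidified` -- [ED. 7] Literature `MumfordDual.dualPairOfAmpleRigidified` (payer of `stub_PEL`, DUALS slot — [MumfordAV1970] §13)
- `import Summits.HodgeConjecture.HodgeConjecture.Theorems.F0P6aDatumOfLine` -- [ED. 7] ★ p854153 D-LINE CAPSTONE `F0P6aDatumOfInputs.datum_of_line_star : DatumOfLineType` (payer of `stub_DATUM`; = `datum_of_inputs_star` at the three ★ leaf heads, MAIN :62–:65)
- `import HarnessLib`
- `import HarnessLib.Audit.LibrarySuggestionsDenyListCruxes` -- build-lane export guard (operator companion req547; LEAD «M-119b∕c»: every new `Lines` edition carries it)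

# EDITION 7 («DEAD LETTERS PAID BY ★ TERMS», 2026-09-03; desk F0P6c-plan (g11) cand v2 by copy over ED. 6 c955f53f42ee6add, spec = box LAref-P (g8) #86b (13:21:14Z); written ONLY on a LEAD numbered cue in a declared
window; this hub has NO `Lines` importer and lies in NO registered cone, so its request is {this module} alone): ED. 6 + SIX imports (★ `Theorems.F0P6aPELInputs` ∕ `F0P6aPELSpreadDefs` ∕ `F0P6aStubGSPREAD` ∕
`F0P6aStubGEN`, Literature `DualPairOfAmpleRigidified`, ★ `Theorems.F0P6aDatumOfLine` — all ★∕Literature, none imports a `Cruxes` module ⇒ no cycle; all lie in MAIN ★ `Theorems.F0P6aModuliDatum`՚s closure, which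
LAref-P #86b elaborated TOGETHER with this hub ⇒ no name clash) with the header made CANONICAL («M-142a» (A): the ED. 6 import notes moved verbatim into «## Import provenance» above) + the two registered sockets
PAID BY TERM: `stub_PEL := F0P6aPELInputs.pel_of_inputs (F0P6aPELSpread.spread_of_parts F0P6aStubGSPREAD.gspread_of_line F0P6aPELSpread.stub_INJ0 F0P6aStubGEN.elaws_of_line) MumfordDual.dualPairOfAmpleRigidified`
(= MAIN ★ `Theorems/F0P6aModuliDatum.lean` :56–:61, the P-argument of `stub_RGD`, TOKEN FOR TOKEN; LAref-P `PEL_payable` TRIO) and `stub_DATUM := F0P6aDatumOfInputs.datum_of_line_star` (★ p854153, the D-LINE CAPSTONE = `datum_of_inputs_star` at the three ★ leaf heads, i.e. MAIN :62–:65 folded into one ★ name;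
desk F0P6c-plan census A v4 pin (e′) `capstone_in_socket : type_of% @stub_DATUM := datum_of_line_star` TRIO; LAref-P `DATUM_payable` TRIO).
0 statement bytes changed; every FQN kept (`stub_PEL`, `stub_DATUM`, `rgd_of_parts`); live literal `sorry`s: 2 → 0; `#print axioms rgd_of_parts` = `… stub_PEL` = `… stub_DATUM` = [propext, Classical.choice, Quot.sound]
(were `sorryAx`); the spine head `rgd_of_parts = rgd_of_inputs stub_PEL stub_DATUM` now unfolds to MAIN՚s `stub_RGD` body (LAref-P `J_RGD_LofS` TRIO; the converse `J_RGD_SofL : type_of% @F0P6aModuliDatum.stub_RGD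
:= @rgd_of_parts` becomes TRIO at this edition).  Digits ∕ registries UNCHANGED (24832 ← `Lines/d6_cm_curve.lean` {1}; 27458 ∅; MAIN՚s cone reads ★ only); count-neutral hygiene (tree code-`sorry`
inventory −2; with `Lines/F0_P6a_PELSpread.lean` ED. 4 every `Cruxes/HLiu418/Lines/F0_P6a_*` module is literally `sorry`-free).  The ED. 6 clause «live literal `sorry`s: 2 = {`stub_PEL`, `stub_DATUM`}» below is
SUPERSEDED by this paragraph and kept for the record.
HC_CM is proved only modulo the 7 printed citations (2 remaining named inputs hLiu418 = stmt-HodgeConjecture-24832, h413 = stmt-HodgeConjecture-24833) until rung 0 closes.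

# EDITION 6 (K5-H1 «SHIM + SOCKETS», 2026-09-02; LA7-plan (g7) cand v2, written only on the LEAD heir՚s «M-141+» cue; ED. 5 = desk F0P6a-plan «M-71» (1) af4215361d5a2d8f): this hub now IMPORTS its ★ re-home
`Theorems/F0P6aRGDAssemblyDefs.lean` (tree bytes of ED. 5 af4215361d5a2d8f minus the three blocks kept here, namespace KEPT) and keeps, VERBATIM from ED. 5 and in the SAME namespace,
EXACTLY the two registered sockets `stub_PEL` (ED. 5 :509), `stub_DATUM` (ED. 5 :552) and the junction `rgd_of_parts := rgd_of_inputs stub_PEL stub_DATUM` (ED. 5 :603) — so every FQN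
(`…F0P6aRGDAssembly.stub_PEL`, `….stub_DATUM`, `….rgd_of_parts`, and through the import `….rgd_of_inputs`, `….RGDInputsAt`, …), the D-LINE junction `type_of% @stub_DATUM := @datum_of_line`,
the P-LINE՚s `RecordPELInputsCofinal`, and the books՚ socket census of this file (live literal `sorry`s: 2 = {`stub_PEL`, `stub_DATUM`}, both OFF-PATH, closed BY NAME downstream) are UNCHANGED.
The ED. 5 module docstring follows verbatim.

# `F0_P6a_RGDAssembly` — THE GEN INTEGRATOR՚S SPINE for `stub_RGD : RecordModuliDatumCofinal` (A-p18 (g31); LEAD F0P6-plan (g2) R-CUT 21:03:23Z, M-17m′ door (E))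

CRUX `stmt-HodgeConjecture-24832` (HLiu418), sub-line P6a, socket `stub_RGD` (main `Lines/F0_P6a_ModuliDatum.lean` :569∕:570).  Ledger of record: `CENSUS-RGD-ASSEMBLY.v1`
09be7b9d (85 leaf rows).  HC_CM is proved only modulo the 2 remaining named inputs (hLiu418 24832, h413 24833) until rung 0 closes; this workfile asserts nothing
beyond its registered `sorry` stubs.

WHY THIS SPINE.  The letter `RecordModuliDatumCofinal` is `∀ letter-context K, ∃ (GEN՚s choices Fᵢ Kc G φ 𝓜 S_M), ∀ good w, hyperspecial ∧ ∀ h𝓨 θ hθ e, hdisj ∧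
Nonempty (ModuliDatum …)`.  The census splits its proof into TWO masses that never talk to each other except through the LOCALISED PEL TUPLE: (vi) «what
`univ act dual pol g N lvl pChar … twistIdeal twistNorm` ARE» (door (E) + SPREAD + the level block, COFINITELY in `w`) and (i)–(v) «the 33 fields of `ModuliDatum`
from that tuple» (carriers, `inj₀`, readings, dock, roofs — AT EACH `w`).  This file TYPES the interface between the two masses — `structure RGDInputsAt` (§1:
the tuple over `𝓨 = (𝓜.localise w).total` + Kottwitz at `Ω`-points with its `c•w`-count (A-p17՚s (K-Ω)∕`h1` currency), Rosati, relative dimension `[F:ℚ]`,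
commutativity, the arithmetic of `w` (`pChar hpChar fDeg charP₀`), the twist data with (f6) coprimality) — and PROVES the letter from two stubs:
* `stub_PEL : RecordPELInputsCofinal` (§2) — the letter with `Nonempty (ModuliDatum …)` replaced by `Nonempty (RGDInputsAt …)`: GEN՚s own assembly of ★ (O-ζ)
  p846419 (level block), the E-line head `pelWitnessE_of_line` (door (E)), ★ SP1 p846825 + sequels (spread to `𝓞_{Fᵢ}[1∕M]`, localise), ★ GEO-PKG p845032∕p845310
  (model, `hdisj`), (U1-c) `KottwitzConditionClosed` (ℂ-points → `Ω`-points), ★ p846847 (U1-d) + ★ p846856 (S-H-E′) (the count), (C2) ★ p846565 (twist ideal shape);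
* `stub_DATUM : ∀ …, RGDInputsAt … → Nonempty (ModuliDatum …)` (§3) — the (i)–(v) assembly at each `w` (carriers `Line∕Sub∕kerF∕IsEtale∕sp` glue, SP3 `inj₀`, SP4∕SP5,
  (U4) `hecke`∕`RoofΩ`, the K∕BT dock ★ `blockDocking_of_line` (sockets 2∕2 ★), the W-dock, `RoofΩ→Roof₀` and `CoverΩ→FrobCover₀` reductions) — ED. 2 of this
  file splits it field-group by field-group once the carrier DEFINITIONS land (GEN, next).
HEAD `rgd_of_parts : RecordModuliDatumCofinal` (sorry-free given the two stubs; = the future body of `stub_RGD`).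

EDITION 5 (2026-09-02, desk F0P6a-plan (g4) as collector∕writer — GEN spine pen A-p18 (g32) CLOSED 05:53:46Z; LEAD heir F0P6-plan (g3) «M-71» (1): (e1) RULED = (H1) LAW FIELD;
P6c (g5) (e1) census 06:03:07Z, LAref-D (g0) 06:12:12Z (3), LA1-plan (g3) pre-cert f1cde0c3 + cand v1 39c0fea9 (prose adopted, LEAD՚s tokens win), desk cost sheet 06:13:24Z):
ONE ADD-ONLY `RGDInputsAt` LAW FIELD in the arithmetic-of-`w` block next to `hpChar` (row count `nRGD` 40 → 41): (R-unr) `hunr : ¬ (w.asIdeal ^ 2 ∣ Ideal.span {((pChar : ℕ) : 𝓞 F)})`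
(«`p` is UNRAMIFIED at `w` to first order: `𝔭_w² ∤ (p)`»; [Liu2021] §D.4 p. 134 «p is unramified in E»).  WHY (LAref-D (1)): for `e(w|p) ≥ 2` the `e_p^λ`-pairing between the `w`- and
`c•w`-layers of `A[p]` is identically trivial, so the D-side (L2 `stub_SPEC`: [WQ] `QuotWellDefLaw` ∕ (ρ2) ∕ Road S) cannot pin the `w`-layer kernel from (P-1) `polQuasiInv` alone, and the
refined duality `A[𝔭_w]^D ≅ A[𝔭_{c•w}]` for every `e` is not in the tree; the interface EXCLUDES the regime ((H2) binder threading ∕ (H3) rejected as wide, «M-71»).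
PRODUCER (P-LINE ED. 3, desk): ONE `where`-row `hunr := hunr` in the zip `inputsOfParts` fed by ONE new hypothesis, and `pel_of_inputs` ENLARGES `S_M` by the FINITE set
`{w | ∃ p prime, 𝔭_w² ∣ (p)}` ⊆ {w ∣ 𝔇_{F∕ℚ}} (★ `Literature.NumberTheory.NumberFields.finite_setOf_sq_dvd_span_natCast`, p849762 LA6-p02 (g2); Mathlib `differentIdeal_ne_bot`,
`Ideal.finite_factors`), the local step off it being `fun h => hwD ⟨pChar, hpChar.1, h⟩`.  CONSUMERS read `I.hunr` by projection (the `c•w` twin is a lemma — `c` fixes `(p)` — no field;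
L2 keeps `hunr` an explicit binder of its (ρ2)∕Road-S lemmas, never an `e ≥ 2` case split).  PARAMETER LIST, every ED. 2∕3∕4 row, the letters `RecordPELInputsCofinal` ∕
`RecordDatumOfInputs`, the registered statements `stub_PEL` ∕ `stub_DATUM`, the heads `rgd_of_inputs` ∕ `rgd_of_parts` and the §4 dock are BYTE-IDENTICAL to ED. 4 ⇒ every consumer
(D-LINE ED. 2, L1∕L2∕L3 leaves, LS∕COV0∕QFEI leaflets, KOTT, E-READINGS, GEN leaf, L4 leaf, MAIN ED. 8, top) elaborates unchanged by projection (LA1-plan (g3) by-copy leg f1cde0c3: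
spine-with-field + D-LINE ED. 2 + L1 leaf rc 0 ∕ sorries 5 ∕ TRIO; the ONLY constructor of `RGDInputsAt` in the cone is the P-line zip, `rg` census LA1-plan (1)).  JUNK-SAFETY:
where the field is false `RGDInputsAt … w` is EMPTY — exactly «`w ∈ S_M`» in the letter; no socket is weakened in truth.  KICK PROTOCOL («M-71»): K1 = {`F0_P6a_RGDAssembly`} ALONE →
BUILT → P-LINE ED. 3 written → K2 = {`F0_P6a_PELInputs`} + every reverse dep of the spine in ONE request.  Live tree-local `sorry`s of THIS file: 2 (`stub_PEL`, `stub_DATUM`), unchanged.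

EDITION 4 (A-p18 (g32), GEN pen; LEAD «M-57» 02:07:47Z + «M-57b»∕«M-57c» + 02:17:54Z (b), rows of record, FIELDS-FIRST while the P-line is unwritten — «M-41» held until
the ED. 4 cone is BUILT): SIX NEW `RGDInputsAt` LAWS after `twistNorm_frob` (rows 35–40 of 40) — first the four of cand v1: (B-1) `m_pair : m τ + m (τ ∘ c) = 2` and `m_banal : τ ∤ w, c•w → m τ = 0 ∨ m τ = 2` (GEN Q-MIX′ 02:03:15Z: the banal values of the signature are
constrained by nothing in ED. 3, and without them (rL) of `Roof₀` is false on a banal `(1,1)` pair; door (E) pays both by definition of `mOf`), (π1) `twistIdeal_coprime_conj :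
𝔞_γ ⊔ 𝔭_{c•w} = ⊤` and (π2-G) `frobKernel_banal : FrobKernelBanal₀ … (twistIdeal γ)` at a Frobenius-reading `γ` (LA3-plan (g0) «Q-ROOF-α» memo 819cf5b7 + LA-ref1 (g0) box L3 #1 A4
RED + LEAD «M-57»: `stub_ROOF0` v2 is false as typed because the Frobenius cover pins `𝔞_γ` only modulo `U_N = {α : αᾱ = 1, α ≡ 1 (N), (α) over p}`; the pin (π1)+(π2-G) is what
(rL) reads and the D-side cannot derive it) — (π2-G) packaged as the ONE-`Prop` helper `FrobKernelBanal₀` (tokens = LA3-plan՚s `FrobPin₀` conjunct verbatim, tuple-parametric).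
Cand v2 (LEAD «M-57b»∕«M-57c» FINAL ROW LIST + 02:17:54Z (b)): two more add-only rows — (B-2) `m_unmixed` (the frame is constant on the embeddings inducing one banal place; the
regime under which door (E) pays (π2-G) elementarily) and (K-law) `coverKerΩ : ∀ e′ γ y, CoverKerΩ …` with the ONE-`Prop` helper `CoverKerΩ` = Defs `CoverΩ` :409 text + (t1′) the
scheme-theoretic kernel clause `Ker c = A[𝔞]` inside the same `∃ c` (A-p03 (g30) Q-COV-KER; road A of `stub_COVER0` becomes organ-complete); `nRGD` 34 → 40.  F-PIN-can
(`twistIdeal γ = ∏ 𝔭_v^{k_v}`, GEN memo §1; M-57c row 40) is DROPPED as a field (LEAD 02:17:54Z (b): no D-side consumer under the L3 line of record v4).  PARAMETER LIST, the ED. 3 rows,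
the letters, the heads and the §4 dock are BYTE-IDENTICAL to ED. 3; consumers by projection (D-line, KOTT leaf, main ED. 6) elaborate unchanged; the P-line literal `inputsOfParts`
takes four more feeds (v6g: (B-1) next to the KOTT law, (π1)+(π2-G) as guarded conjuncts of `PELTwistLawAt`).

EDITION 3 (A-p18 (g32), GEN heir; desk heir F0P6a-plan (g4) W2′ «FIELDS FIRST» 01:04:02Z, LEAD «M-39»∕«M-40» closing-window list of record): (a) THREE NEW `RGDInputsAt` LAWS —
(P-1) `polQuasiInv : ∃ d ν, IsMonHom ν ∧ pChar.Coprime d ∧ pol.lam ≫ ν = univ.mulN d` (LEAD 00:06:48Z tokens; the W-dock՚s `hlam` road), (FROB-𝔞) `twistIdeal_frob`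
(`𝔭_w ∣ 𝔞_γ` at a Frobenius-reading `γ`) and (FROB-n) `twistNorm_frob` (`n_γ = p^{f_w}` likewise) — binders VERBATIM Defs `FrobReading₀.frobIdeal_spec`∕`twistNorm_eq`, conclusions
VERBATIM A-p03 (g30) `stub_WDIV`∕`stub_WNORM` (Q-FROB-1, LEAD 00:44:18Z (2)): the D-line FROB closer then reads them as projections; the PARAMETER LIST of `RGDInputsAt` is
unchanged, so every binder∕projection consumer (D-line cand v2, main ED. 6) elaborates unchanged and only the P-line՚s structure literal `inputsOfParts` grows (+3 feeds, before
its first write «M-41»); (b) the (i)–(v) letter NAMED `RecordDatumOfInputs` (= the TYPE of `stub_DATUM` token for token; `stub_DATUM` keeps its registered statement); (c) the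
PARAMETRIC HEAD `rgd_of_inputs (hPEL) (hDATUM) : RecordModuliDatumCofinal` (no stub inside) with `rgd_of_parts := rgd_of_inputs stub_PEL stub_DATUM` (name∕type unchanged ⇒
main ED. 6 rebuilds byte-identically); main ED. 7 = `stub_RGD := rgd_of_inputs pel_of_line datum_of_line` once both pay-down leaves are BUILT.  §4 dock BYTE-IDENTICAL to ED. 2.

EDITION 2 (A-p18 (g31); cand v3 = cand v2 + LEAD «M-26-pre»: (L1′) the AT-`w` special injectivity `inj₀` TOKEN-IDENTICAL to `ModuliDatum.inj₀` (o-14) and (ii-6″) `twistIdeal_ne_bot`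
TOKEN-IDENTICAL to Defs ED. 3 :933 (M-24) as the 30th∕31st fields — both class (A) for `stub_DATUM` —, and the o-13 BUDGET cure — `KottwitzΩ`∕`DockPackage` packaged as `Prop`s, `hK`∕`h1` hoisted (`RGDInputsAt.charpoly_eq_prod_τR`, `RGDInputsAt.sum_m_filter_residue_eq_one`), so that EVERY
declaration elaborates at the DEFAULT `maxHeartbeats` (no override anywhere; `synthInstance` 100 000 on the two decls that state P6d՚s double-twist clause, cf. P6d :89); cand v2 adds the F0P5a-ref1 (g7) n2 INPUT LAWS (L1) `injΩ` (generic fine-moduli injectivity PER SHEET, `tupleIsoAt` at `genPt`), (L4)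
`heckeRoofΩ` (the two Hecke operators at `w` as generic isogeny roofs ★ `RoofΩ`, with the line bijection `β ↦ H_β`), (L5) `coverΩ` (generic Serre covers ★ `CoverΩ` between sheets); (L2)
«exact level» has NO reader once (L1)(L4) are inputs — it lives inside `stub_PEL` (TOKEN = DROP); so the split is «door (E) incl. (U4)∕twist readings» = `stub_PEL`
vs «reductions + carriers + docks» = `stub_DATUM`, PEL heavier ∕ DATUM lighter than ED. 1): (i) `RGDInputsAt.kottwitzΩ` now quantifies over ALL `Ω`-points of the thickened generic fibre `Y = (thickening F Fᵢ)(S.M Kc)` (every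
sheet, not only `e`) in the (S-T) currency `((univ.baseChange ιη).baseChange y.left)` ∕ `homMk (Grp.ofHom (… .i b))` of ★ p846836՚s `hK` — the lift of a special
point may land on any sheet, and Kottwitz is sheet-independent (the reflex field of the signature lies in the Galois `F`); (ii) `hfDeg` ∕ new `hpCharConj` are stated
at the block place `c•w` (the dock՚s `hf` ∕ `hpw` by name); (iii) §4 NEW, SORRY-FREE: `blockDock_of_inputs` — the K∕BT DOCK `blockDocking_of_line` AT EVERY SPECIAL
POINT `x̄`, ALL ITS INPUTS DISCHARGED FROM `RGDInputsAt` + ★ (O-CRT) (block family) + ★ (S-H) p846766 + ★ (S-T) p846836 + the count `m_count` through ★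
`map_blockIdempotent_one_eq_one_iff` — i.e. the 23 K-rows `G₀ … hsimple₀` of `BlockReading₀` are CLOSED BY NAME given the localised PEL tuple (census (ii)).
[cite: RapoportSmithlingZhang2020Diagonal, §4.1 Thm. 4.1 p. 17] [cite: Kottwitz1992, §5 pp. 389–391] [cite: Liu2021, Rem. C.2 p. 108, Prop. D.8 p. 135]
-/

set_option autoImplicit false

noncomputable section

namespace Summit.HodgeConjecture.HodgeConjecture.Cruxes.HLiu418.F0P6aRGDAssembly

set_option linter.dupNamespace false  -- `Summit.HodgeConjecture.HodgeConjecture.…` BY DESIGN (D-0017)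

open CategoryTheory CategoryTheory.Limits NumberField IsDedekindDomain MulAction
open scoped Matrix Polynomial Pointwise
open Literature.NumberTheory.GaloisRepresentations
open Literature.NumberTheory.Automorphic Literature.NumberTheory.Automorphic.UnitaryGroup
open Literature.AlgebraicGeometry.ShimuraVarieties.UnitaryCanonicalModel
open Literature.NumberTheory.Automorphic.Liu2021.AppendixC
open Literature.AlgebraicGeometry.Motives (AlgPoints IntegralModel SchemeOver thickening thickeningGalAction thickeningLift relFrobeniusOver frobSpec)
open Literature.NumberTheory.DiophantineGeometry (geomResidueField specialFibreFunctor)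
open Literature.AlgebraicGeometry.RelativeSpec (ActionOver)
open Literature.NumberTheory.EllipticCurves (genericFibre)
open AlgebraicGeometry (QuasiCompact QuasiSeparated LocallyOfFinitePresentation Flat IsSeparated)
open Summit.HodgeConjecture.HodgeConjecture.Cruxes.HLiu418.F0P6aModuliDatumDefs

/-- **PAID BY TERM at ED. 7** (MAIN ★ `Theorems/F0P6aModuliDatum.lean` :56–:61 token for token: `pel_of_inputs (spread_of_parts gspread_of_line stub_INJ0 elaws_of_line) dualPairOfAmpleRigidified` — ★∕Literature, sorry-free, TRIO; statement UNCHANGED: LAref-P (g8) #86b `PEL_payable` TRIO).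
**`stub_PEL` — THE (vi) MASS: GEN՚s choices and the localised PEL tuple with its laws, COFINITELY in `w`** (★ (O-ζ) level block p846419 ⊕ E-line head
`pelWitnessE_of_line` (door (E)) ⊕ ★ SP1 p846825 + sequels ⊕ ★ GEO-PKG p845032∕p845310 ⊕ (U1-c) closedness ⊕ ★ (U1-d) p846847 ∕ (S-H-E′) p846856 ⊕ (C2) ★ p846565;
`S_M ⊇` primes under the level, ramified in `Fᵢ`, SPREAD-bad for some frame, `hdisj`-exceptional, AND (ED. 2, LEAD M-26-pre (L1′)) `S_M ⊇ Σ_Isom` — the special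
injectivity `inj₀` at every good `w` by the COFINITE passage: SP3-a2 `PolarizedTupleIsomSchemeFiniteType` (mint #4) + ★ SP3-b p846927 + ★ INT-RES p846333∕p846657 + door (E)
generic injectivity (tower separation ★ `UnitaryCurve.eq_of_forall_siegelPointMap_eq` + Deligne stationarity at GEN՚s principal `Kc`)).  GEN՚s own; split along those seams.
[cite: RapoportSmithlingZhang2020Diagonal, §4.1 Thm. 4.1 p. 17] [cite: Kottwitz1992, §5 pp. 389–391] -/
theorem stub_PEL : RecordPELInputsCofinal :=
  Summit.HodgeConjecture.HodgeConjecture.Cruxes.HLiu418.F0P6aPELInputs.pel_of_inputs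
    (Summit.HodgeConjecture.HodgeConjecture.Cruxes.HLiu418.F0P6aPELSpread.spread_of_parts
      Summit.HodgeConjecture.HodgeConjecture.Cruxes.HLiu418.F0P6aStubGSPREAD.gspread_of_line
      Summit.HodgeConjecture.HodgeConjecture.Cruxes.HLiu418.F0P6aPELSpread.stub_INJ0
      Summit.HodgeConjecture.HodgeConjecture.Cruxes.HLiu418.F0P6aStubGEN.elaws_of_line)
    Literature.AlgebraicGeometry.AbelianSchemes.MumfordDual.dualPairOfAmpleRigidified

/-- **PAID BY TERM at ED. 7** (★ p854153 `F0P6aDatumOfInputs.datum_of_line_star : DatumOfLineType` — the D-LINE CAPSTONE, `datum_of_inputs_star` at the three ★ leaf heads `L1Fold.stub_LINES_of_organs` ∕ `F0P6aStubDOWN.stub_DOWN_of_organs` ∕ `F0P6aStubFROB.stubFROB_of_parts` (MAIN :62–:65); sorry-free, TRIO; statement UNCHANGED: census A v4 pin (e′) ∕ LAref-P (g8) #86b `DATUM_payable` TRIO).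
**`stub_DATUM` — THE (i)–(v) MASS: the 33 fields of `ModuliDatum` from the localised PEL tuple with its laws, AT EACH `w`** (carriers `Line∕Sub∕kerF∕IsEtale∕sp`
BY CONSTRUCTION over ★ `AdmSub`∕`kerFI`∕`IdealIsEtale`; `inj₀ := I.inj₀` (class (A), ED. 2 (L1′)); SP4 `quot := red₀ ∘ quotΩ` well-defined + `red_quotΩ`∕`red_translΩ`; SP5 `smap` laws;
(U4) `hecke` ∕ `quotΩ`∕`translΩ` as the isogeny roofs `RoofΩ`; `block₀` by ONE `obtain` from §4 `blockDock_of_inputs` = ★ P6d ED. 7 `blockDocking_of_line` with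
every input discharged (sockets (S-H) ★ p846766, (S-T) ★ p846836, GEN inputs `h𝓨`, `relDim`, `comm`, `kottwitzΩ`∕`m_count`); `frob₀` by reduction of `RoofΩ`∕`CoverΩ` along the ★ (ν)-chain + the W-dock junction
`bigBlockFrobeniusLaw_of_heads`).  ED. 2 of this file splits it field-group by field-group over the carrier DEFINITIONS (GEN, next).
[cite: Liu2021, Prop. D.8 p. 135, pp. 136–138] [cite: HarrisTaylorAMS2001, §III.4, pp. 108–110] [cite: RapoportSmithlingZhang2020Diagonal, §4.3 (4.23) p. 21] -/
theorem stub_DATUM : ∀ (F : Type) [Field F] [NumberField F] [IsCMField F] [IsGalois ℚ F] (ι₁ : F →+* ℂ)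
    (Jstar : Matrix (Fin 2) (Fin 2) F)
    (K₀ : C5.OpenCompactSubgroup ↥(finAdelic ↥(maximalRealSubfield F) F (IsCMField.complexConj F) 2 Jstar))
    (S : RecordSystemGS F Jstar ι₁ K₀) (hU7ₛ : S.HeckeTranslateDefinedOver)
    (hJ : (Jstar.map (IsCMField.complexConj F))ᵀ = Jstar) (hJu : IsUnit Jstar)
    (Fi : Type) [Field Fi] [Algebra F Fi] [FiniteDimensional F Fi] [IsGalois F Fi]
    (Kc : C5.SmallLevel K₀) (G : Type) [Group G] [Finite G]
    (𝓜 : IntegralModel (𝓞 F) F ((thickening F Fi).obj (S.M.obj Kc)))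
    (w : HeightOneSpectrum (𝓞 F)) (hw : (IsCMField.complexConj F) • w ≠ w) (h𝓨 : (𝓜.localise w).IsSmoothProper 1)
    (θ : ActionOver (𝓜.localise w).total.hom ((Fi ≃ₐ[F] Fi) × G))
    (_hθ : ∀ γ : Fi ≃ₐ[F] Fi,
       (genericFibre (HeightOneSpectrum.valuationSubringAtPrime F w) F).map
             (Over.isoMk (θ.aut (γ, 1)) (θ.aut_comp (γ, 1))).hom ≫ (𝓜.localise w).genericIso'.hom
         = (𝓜.localise w).genericIso'.hom ≫
             (Over.isoMk ((thickeningGalAction (L := Fi) (S.M.obj Kc)).aut γ)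
               ((thickeningGalAction (L := Fi) (S.M.obj Kc)).aut_comp γ)).hom)
    (e : Fi →ₐ[F] AlgebraicClosure (w.adicCompletion F))
    (_hunit : (UnitaryGroup.isUnit_placeForm Jstar hJu w).unit ∈ glInt 2 (w.adicCompletion F))
    (_hKc : UnitaryGroup.IsHyperspecialAt ↥(maximalRealSubfield F) F (IsCMField.complexConj F) 2 Jstar Kc.1.1
      (w.under (𝓞 ↥(maximalRealSubfield F))))
    (_hdisj : haveI : AlgebraicGeometry.IsProper (𝓜.localise w).total.hom := h𝓨.2
      ∀ (β : Fi ≃ₐ[F] Fi) (P Q : AlgPoints (S.M.obj Kc) (AlgebraicClosure (w.adicCompletion F))),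
        (𝓜.localise w).geomReductionMap (thickeningLift e (S.M.obj Kc) P) =
          AlgPoints.map ((specialFibreFunctor w).map (Over.isoMk (θ.aut (β, 1)) (θ.aut_comp (β, 1))).hom :
              (𝓜.localise w).reductionAt ⟶ (𝓜.localise w).reductionAt)
            ((𝓜.localise w).geomReductionMap (thickeningLift e (S.M.obj Kc) Q)) → β = 1),
    RGDInputsAt F ι₁ Jstar K₀ S hU7ₛ hJ hJu Fi Kc G 𝓜 w hw h𝓨 θ e →
      Nonempty (ModuliDatum F ι₁ Jstar K₀ S hU7ₛ hJ hJu Fi Kc G 𝓜 w hw h𝓨 θ e) :=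
  Summit.HodgeConjecture.HodgeConjecture.Cruxes.HLiu418.F0P6aDatumOfInputs.datum_of_line_star

/-- **HEAD `rgd_of_parts : RecordModuliDatumCofinal`** (modulo `stub_PEL`, `stub_DATUM`) — `rgd_of_inputs` AT THE TWO REGISTERED STUBS; the name main ED. 6 imports
(`stub_RGD := rgd_of_parts`, :588) — unchanged in name and type, so main rebuilds byte-identically.  Sorry-free given the stubs.
[cite: RapoportSmithlingZhang2020Diagonal, §4.1 Thm. 4.1 p. 17] [cite: Liu2021, Rem. C.2 p. 108, Lemma C.18 p. 115, proof of Prop. C.20 p. 118] -/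
theorem rgd_of_parts : RecordModuliDatumCofinal :=
  rgd_of_inputs stub_PEL stub_DATUM

end Summit.HodgeConjecture.HodgeConjecture.Cruxes.HLiu418.F0P6aRGDAssembly

end
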